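import Literature.MathematicalPhysics.QuantumLattice.DWaveSourceNNNHoppingWindowHamiltonian
import HarnessLib

/-!
# Window certificates for the pair-sourced `t–t'` Hubbard tori (energy per site; orbit-averaged
# expectations of `S^z`-eigenvector eigenstates below an energy cap)

Topic `MathematicalPhysics/QuantumLattice`, family `hubbard`. Sequel of
`DWaveSourceNNNHoppingWindowHamiltonian.lean` (window Hamiltonian `H^{src,tt'}_{Λ'}`, locality, objective)
and `DWaveSourceNNNHopping.lean` (torus theorem) for the PINNING-FIELD `t–t'` torus
`A_L = dWaveSourceTorusTT' L tp U μ h` (Koma–Tasaki 1994 §1 source, Xu et al. 2024 eq. (1) hoppings);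
the nearest-neighbour energy statement is `dWaveSourceTorus_groundEnergy_ge_of_window_certificate_d4`, the
particle-number conserving observable statement `re_orbitState_ge_of_window_certificate_d4_TT'_ineq`.

* `dWaveSourceTorusTT'_groundEnergy_ge_of_window_certificate_d4` (+ `_eventually`, library instances):
  ONE window identity `E^{src,tt'} − c·1 = SOS + Σ[H^{src,tt'}_{Λ'}, Γ(incl)Bₖ] + Σ(affine-D₄ defects,
  χ_{B₁g}(γₗ) = 1) + Σ bⱼ wⱼ (S^z-charged words) + Σ dₘ(Vₘᴴ − Vₘ) + Σ aₖ vₖ` gives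
  `(c − Σ‖aₖ‖)·L² ≤ E₀(A_L)` on the full Fock space of every large torus (Han 2020 §3 through the tracial
  ground state, Bratteli–Robinson II §6.2.4) — the energy FLOOR slot of the pinning-field menus at `t' ≠ 0`.
* `re_orbitState_ge_of_sourced_window_certificate_d4_TT'_ineq` (+ `_of_energy_le`): ONE identity
  `X − c·1 − κ(u·1 − E^{src,tt'}) = …` gives, for every large `L`, every real `M`, labels `S ∋ 1` closed
  under products with `χ_{B₁g} = 1`, and every unit `ψ ∈ fockSpinZSector M` with `A_L ψ = E ψ`:
  `c − Σ‖aₖ‖ + κ(u − E/L²) ≤ Re ω̄_ψ(Γ(ι_{Λ',L}) X)` (Wang et al. 2024 §III) — verbatim the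
  eigenvector-below-cap cell `Summit.Ventures.CertifiedManyBodySolver.SourcedTorusCorrLowerRow`.

No density multipliers (the particle number is not a charge of the sourced problem). HONEST SCOPE: soundness
only — no certificate is constructed or claimed; a bound at fixed `h > 0` says nothing about `d`-wave order of
the Hubbard model. Everything is PROVED; no definition, no named fact.

References: [cite: KomaTasaki1994, §1] [cite: WangEtAl2024, §III] [cite: Han2020Bootstrap, §3]
[cite: BratteliRobinsonII1997, §6.2.4]
-/
noncomputable section

namespace Literature.MathematicalPhysics.QuantumLattice

open Matrix Finset HubbardWave0 Literature.Probability.LatticeModels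
open Literature.MathematicalPhysics.QuantumManyBody.StateRelaxation
open scoped ComplexOrder BigOperators

section Certificate

variable {L : ℕ} [NeZero L]

/-- (Local to this section, as in `DWaveSourceWindowCertificate[D4]` / `HubbardNNNHoppingCorrelatorWindowCertificate`.)
[folklore] -/
local instance (priority := high) instDecidableEqFermionTorusSrcTTWindow : DecidableEq (FermionTorus 2 L) :=
  LinearOrder.toDecidableEq

/-- **Window certificate with affine `D₄` reductions ⇒ ground-state energy of EVERY large pair-sourced
`t–t'` torus**: the identity in `𝔄_{Λ'}` (`thicken Λ 1 ⊆ Λ'`, `χ_{B₁g}(γₗ) = 1`, `S^z`-charged `wⱼ`)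
`E^{src,tt'} − c·1 = Σ Λₐᵦ Oₐᴴ O_b + (Σₖ [H^{src,tt'}_{Λ'}, Γ(incl)Bₖ] + Σₗ (Γ(incl)(Γ(d4Emb γₗ vₗ) Yₗ) − Γ(incl) Yₗ)
 + Σⱼ bⱼ • wⱼ) + (Σₘ dₘ • (Vₘᴴ − Vₘ) + Σₖ aₖ • vₖ)` gives, for every `L ≥ 3` with `x ↦ x mod L` injective on
`thicken Λ' 1`, `(c − Σₖ ‖aₖ‖) · L² ≤ E₀(dWaveSourceTorusTT' L tp U μ h)` (full Fock space; Han 2020 §3 read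
through the tracial ground state). [cite: Han2020Bootstrap, §3] -/
theorem dWaveSourceTorusTT'_groundEnergy_ge_of_window_certificate_d4 (tp U μ h : ℝ) (hL : 3 ≤ L)
    {Λ Λ' : Finset (Site 2)} (hΛ : Λ ⊆ Λ') (h8 : thicken Λ 1 ⊆ Λ')
    (h0 : thicken ({0} : Finset (Site 2)) 1 ⊆ Λ') (hz : (0 : Site 2) ∈ Λ')
    (hP : pairRegion (insert (0 : Site 2) unitSteps) 0 ⊆ Λ')
    (hInj : Set.InjOn (Torus.proj (d := 2) L) ↑(thicken Λ' 1))
    {m : Type*} [Fintype m] [DecidableEq m] {Λm : Matrix m m ℂ} (hΛm : Λm.PosSemidef)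
    (O : m → FermionOp Λ')
    {κ : Type*} (s : Finset κ) (B : κ → FermionOp Λ)
    {ι : Type*} (tt : Finset ι) (gam : ι → DihedralGroup 4) (v : ι → Site 2)
    (hgam : ∀ l ∈ tt, b1gChar (gam l) = 1) (hsh : ∀ l, d4ShiftSet (gam l) (v l) Λ ⊆ Λ') (Y : ι → FermionOp Λ)
    {χ : Type*} (u : Finset χ) (b : χ → ℂ) (cw : χ → List (Orb (PolySite Λ') × Bool))
    (hcw : ∀ j ∈ u, ladderSpinCharge (cw j) ≠ 0)
    {δ : Type*} (ah : Finset δ) (dc : δ → ℝ) (V : δ → FermionOp Λ')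
    {κ'' : Type*} (w : Finset κ'') (a : κ'' → ℂ) (word : κ'' → List (Orb (PolySite Λ') × Bool)) {c : ℝ}
    (hcert : fermionEmbed (PolySite.incl h0) ((hubbardTTPrimeFermionInteraction 1 tp U).meanEnergyObs 1) -
          (μ : ℂ) • ∑ σ : Fin 2, nAt 0 hz σ -
          (h : ℂ) • (fermionEmbed (PolySite.incl hP) (localPairAt (insert (0 : Site 2) unitSteps) dWaveFormFactor 0) +
            (fermionEmbed (PolySite.incl hP) (localPairAt (insert (0 : Site 2) unitSteps) dWaveFormFactor 0))ᴴ) -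
        (c : ℂ) • (1 : FermionOp Λ') =
      gramForm Λm O +
        (∑ k ∈ s, (pairSourceWindowHamiltonianTT' dWaveFormFactor Λ' tp U μ h * fermionEmbed (PolySite.incl hΛ) (B k) -
            fermionEmbed (PolySite.incl hΛ) (B k) * pairSourceWindowHamiltonianTT' dWaveFormFactor Λ' tp U μ h) +
          ∑ l ∈ tt, (fermionEmbed (PolySite.incl (hsh l)) (fermionEmbed (PolySite.d4Emb (gam l) (v l) Λ) (Y l)) -
            fermionEmbed (PolySite.incl hΛ) (Y l)) +
          ∑ j ∈ u, b j • ladderWord (cw j)) +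
        (∑ m' ∈ ah, ((dc m' : ℝ) : ℂ) • ((V m')ᴴ - V m') + ∑ k ∈ w, a k • ladderWord (word k))) :
    (c - ∑ k ∈ w, ‖a k‖) * (L : ℝ) ^ 2 ≤ (dWaveSourceTorusTT' L tp U μ h).groundEnergy := by
  classical
  have hInj' : Set.InjOn (Torus.proj (d := 2) L) ↑Λ' := hInj.mono (by exact_mod_cast subset_thicken Λ' 1)
  have hInjΛ : Set.InjOn (Torus.proj (d := 2) L) ↑Λ := hInj'.mono (by exact_mod_cast hΛ)
  set Γ' := fermionEmbed (PolySite.toTorusEmb L hInj') with hΓ'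
  set ΓΛ := fermionEmbed (PolySite.toTorusEmb L hInjΛ) with hΓΛ
  set H := dWaveSourceTorusTT' L tp U μ h with hH
  have hHh : H.IsHermitian := dWaveSourceTorusTT'_isHermitian L tp U μ h
  set X := Γ' (fermionEmbed (PolySite.incl h0) ((hubbardTTPrimeFermionInteraction 1 tp U).meanEnergyObs 1) -
      (μ : ℂ) • ∑ σ : Fin 2, nAt 0 hz σ -
      (h : ℂ) • (fermionEmbed (PolySite.incl hP) (localPairAt (insert (0 : Site 2) unitSteps) dWaveFormFactor 0) +
        (fermionEmbed (PolySite.incl hP) (localPairAt (insert (0 : Site 2) unitSteps) dWaveFormFactor 0))ᴴ)) with hX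
  set T : TorusSite 2 L → Matrix (Finset (Orb (FermionTorus 2 L))) (Finset (Orb (FermionTorus 2 L))) ℂ :=
    fun v' => (fockTranslate v').val with hT
  have hTH : ∀ v', T v' * H = H * T v' := fun v' => fockTranslate_mul_dWaveSourceTorusTT' L v' tp U μ h
  have hTT : ∀ v', (T v')ᴴ * T v' = 1 := fun v' => fockTranslate_conjTranspose_mul_self v'
  have hsum : ∑ v', T v' * X * (T v')ᴴ = H := by
    rw [hH, hX, hΓ']
    exact sum_conj_fockTranslate_pairSourceObjectiveTT'_dWave L h0 hz hP hInj' hL tp U μ h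
  have hK : (⊤ : Submodule ℂ (Fock (Orb (FermionTorus 2 L)))) ≠ ⊥ := top_ne_bot
  set Us : ι → Matrix (Finset (Orb (FermionTorus 2 L))) (Finset (Orb (FermionTorus 2 L))) ℂ :=
    fun l => (fockTranslate (Torus.proj L (v l))).val * (fockD4 (L := L) (gam l)).val with hUs
  set Yt : ι → Matrix (Finset (Orb (FermionTorus 2 L))) (Finset (Orb (FermionTorus 2 L))) ℂ :=
    fun l => ΓΛ (Y l) with hYt
  have hU : ∀ l ∈ tt, Us l * H = H * Us l := fun l hl =>
    d4Affine_mul_dWaveSourceTorusTT' L (gam l) (hgam l hl) _ tp U μ h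
  have hUU : ∀ l ∈ tt, (Us l)ᴴ * Us l = 1 := fun l _ => d4Affine_conjTranspose_mul_self _ _
  set emb : Orb (PolySite Λ') × Bool → Orb (FermionTorus 2 L) × Bool :=
    fun p => (Orb.embMap (PolySite.toTorusEmb L hInj') p.1, p.2) with hemb
  set C : χ → Matrix (Finset (Orb (FermionTorus 2 L))) (Finset (Orb (FermionTorus 2 L))) ℂ :=
    fun _ => HubbardWave0.spinZ with hC
  set W : χ → Matrix (Finset (Orb (FermionTorus 2 L))) (Finset (Orb (FermionTorus 2 L))) ℂ :=
    fun j => (b j / (((ladderSpinCharge ((cw j).map emb) : ℤ) : ℂ) / 2)) • ladderWord ((cw j).map emb) with hW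
  have hC1 : ∀ j ∈ u, C j * H = H * C j := fun _ _ => spinZ_mul_dWaveSourceTorusTT' L tp U μ h
  have hcharged : ∀ j ∈ u, Γ' (b j • ladderWord (cw j)) = C j * W j - W j * C j := by
    intro j hj
    have hq : (((ladderSpinCharge ((cw j).map emb) : ℤ) : ℂ) / 2) ≠ 0 := by
      rw [hemb, ladderSpinCharge_map_embMap]
      exact div_ne_zero (Int.cast_ne_zero.2 (hcw j hj)) two_ne_zero
    rw [fermionEmbed_smul, fermionEmbed_ladderWord, hC, hW]
    simp only [Matrix.mul_smul, Matrix.smul_mul]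
    rw [← smul_sub, spinZ_comm_ladderWord, smul_smul, div_mul_cancel₀ _ hq]
  set M : κ'' → Matrix (Finset (Orb (FermionTorus 2 L))) (Finset (Orb (FermionTorus 2 L))) ℂ :=
    fun k => ladderWord ((word k).map emb) with hM
  have hMc : ∀ k ∈ w, (M k).IsContraction := fun k _ => by
    rw [hM]; dsimp only; rw [ladderWord_eq_prod]; exact isContraction_prod_ladder _
  have htorus : X - (c : ℂ) • (1 : Matrix (Finset (Orb (FermionTorus 2 L))) (Finset (Orb (FermionTorus 2 L))) ℂ) =
      gramForm Λm (fun i => Γ' (O i)) +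
        (∑ k ∈ s, (H * Γ' (fermionEmbed (PolySite.incl hΛ) (B k)) - Γ' (fermionEmbed (PolySite.incl hΛ) (B k)) * H) +
          ∑ l ∈ tt, (Us l * Yt l * (Us l)ᴴ - Yt l) +
          ∑ i ∈ (∅ : Finset (Fin 0)), ((0 : Matrix _ _ ℂ) * ((0 : Matrix _ _ ℂ) - (((0 : ℝ) : ℝ) : ℂ) • 1) +
            ((0 : Matrix _ _ ℂ) - (((0 : ℝ) : ℝ) : ℂ) • 1) * (0 : Matrix _ _ ℂ)) +
          ∑ j ∈ u, (C j * W j - W j * C j)) +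
        (∑ m' ∈ ah, ((dc m' : ℝ) : ℂ) • ((Γ' (V m'))ᴴ - Γ' (V m')) + ∑ k ∈ w, a k • M k) := by
    have key := congrArg Γ' hcert
    rw [fermionEmbed_sub, fermionEmbed_smul, fermionEmbed_one] at key
    have h1 : Γ' (∑ k ∈ s, (pairSourceWindowHamiltonianTT' dWaveFormFactor Λ' tp U μ h * fermionEmbed (PolySite.incl hΛ) (B k) -
        fermionEmbed (PolySite.incl hΛ) (B k) * pairSourceWindowHamiltonianTT' dWaveFormFactor Λ' tp U μ h)) =
        ∑ k ∈ s, (H * Γ' (fermionEmbed (PolySite.incl hΛ) (B k)) - Γ' (fermionEmbed (PolySite.incl hΛ) (B k)) * H) := by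
      rw [fermionEmbed_sum]
      refine Finset.sum_congr rfl fun k _ => ?_
      rw [hH, hΓ', dWaveSourceTorusTT'_commutator_fermionEmbed L hΛ h8 hInj tp U μ h (B k)]
    have h2 : Γ' (∑ l ∈ tt, (fermionEmbed (PolySite.incl (hsh l)) (fermionEmbed (PolySite.d4Emb (gam l) (v l) Λ) (Y l)) -
        fermionEmbed (PolySite.incl hΛ) (Y l))) = ∑ l ∈ tt, (Us l * Yt l * (Us l)ᴴ - Yt l) := by
      rw [fermionEmbed_sum]
      refine Finset.sum_congr rfl fun l _ => ?_
      rw [hUs, hYt, hΓΛ]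
      exact fermionEmbed_toTorusEmb_d4_sub hΛ (gam l) (v l) (hsh l) hInj' (Y l)
    have h3 : Γ' (∑ j ∈ u, b j • ladderWord (cw j)) = ∑ j ∈ u, (C j * W j - W j * C j) := by
      rw [fermionEmbed_sum]
      exact Finset.sum_congr rfl hcharged
    have h4 : Γ' (∑ m' ∈ ah, ((dc m' : ℝ) : ℂ) • ((V m')ᴴ - V m')) =
        ∑ m' ∈ ah, ((dc m' : ℝ) : ℂ) • ((Γ' (V m'))ᴴ - Γ' (V m')) := by
      rw [fermionEmbed_sum]
      refine Finset.sum_congr rfl fun m' _ => ?_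
      rw [fermionEmbed_smul, fermionEmbed_sub, hΓ', fermionEmbed_conjTranspose]
    have h5 : Γ' (∑ k ∈ w, a k • ladderWord (word k)) = ∑ k ∈ w, a k • M k := by
      rw [fermionEmbed_sum]
      refine Finset.sum_congr rfl fun k _ => ?_
      rw [fermionEmbed_smul, hM, fermionEmbed_ladderWord]
    rw [hX, key, fermionEmbed_add, fermionEmbed_add, fermionEmbed_add, fermionEmbed_add, fermionEmbed_add, hΓ',
      fermionEmbed_gramForm, ← hΓ', h1, h2, h3, h4, h5, Finset.sum_empty, add_zero]
  have hmain := Matrix.mul_card_le_minEnergyOn_of_local_certificate hHh ⊤ (fun _ _ => Submodule.mem_top) hK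
    X T hTH (fun _ _ _ => Submodule.mem_top) (fun _ _ _ => Submodule.mem_top) hTT hsum hΛm
    (fun i => Γ' (O i)) s (fun k => Γ' (fermionEmbed (PolySite.incl hΛ) (B k))) tt Us Yt hU
    (fun _ _ _ _ => Submodule.mem_top) (fun _ _ _ _ => Submodule.mem_top) hUU
    (∅ : Finset (Fin 0)) (fun _ => 0) (fun _ => 0) (fun _ => 0) (fun _ => 0)
    (fun i hi => absurd hi (Finset.notMem_empty i)) (fun i hi => absurd hi (Finset.notMem_empty i))
    u C W hC1 (fun _ _ _ _ => Submodule.mem_top) (fun _ _ _ _ => Submodule.mem_top)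
    ah dc (fun m' => Γ' (V m')) w a M hMc htorus
  rw [card_torusSite, Matrix.minEnergyOn_top_holds hHh] at hmain
  exact_mod_cast hmain

/-- **Window certificate with an energy constraint and affine `D₄` reductions ⇒ space-group-averaged
expectation of a local observable in EVERY `S^z`-eigenvector eigenstate of every large pair-sourced `t–t'`
torus**: the identity `X − c·1 − κ (u·1 − E^{src,tt'}) = SOS + Σ[H^{src,tt'}_{Λ'}, Γ(incl)Bₖ] + Σ(affine-D₄
defects) + Σ bⱼ wⱼ (S^z-charged) + Σ dₘ(Vₘᴴ − Vₘ) + Σ aₖ vₖ` gives, for every `L ≥ 3` with `x ↦ x mod L`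
injective on `thicken Λ' 1`, every real `M`, every finite `S ∋ 1` closed under multiplication with
`χ_{B₁g} = 1` on `S` and `γₗ ∈ S`, and every unit `ψ ∈ fockSpinZSector M` with `A_L ψ = E ψ`:
`c − Σₖ ‖aₖ‖ + κ (u − E/L²) ≤ Re ω̄_ψ(Γ(ι_{Λ',L}) X)`, `ω̄_ψ = orbitState (spaceGroupUnitary S) ψ` (Wang et al.
2024 §III / Han 2020 §3, via `dWaveSourceTorusTT'_re_orbitState_ge_of_local_certificate_ineq`).
[cite: WangEtAl2024, §III] -/
theorem re_orbitState_ge_of_sourced_window_certificate_d4_TT'_ineq (tp U μ h : ℝ) (hL : 3 ≤ L) {M : ℝ}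
    {Λ Λ' : Finset (Site 2)} (hΛ : Λ ⊆ Λ') (h8 : thicken Λ 1 ⊆ Λ')
    (h0 : thicken ({0} : Finset (Site 2)) 1 ⊆ Λ') (hz : (0 : Site 2) ∈ Λ')
    (hP : pairRegion (insert (0 : Site 2) unitSteps) 0 ⊆ Λ')
    (hInj : Set.InjOn (Torus.proj (d := 2) L) ↑(thicken Λ' 1))
    (hInj' : Set.InjOn (Torus.proj (d := 2) L) ↑Λ')
    {S : Finset (DihedralGroup 4)} (h1 : (1 : DihedralGroup 4) ∈ S) (hmul : ∀ a ∈ S, ∀ b ∈ S, a * b ∈ S)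
    (hS : ∀ γ ∈ S, b1gChar γ = 1)
    {ψ : Fock (Orb (FermionTorus 2 L))} (hψK : ψ ∈ fockSpinZSector (Λ := FermionTorus 2 L) M)
    (hψ1 : star ψ ⬝ᵥ ψ = 1) {E : ℝ} (hHψ : dWaveSourceTorusTT' L tp U μ h *ᵥ ψ = (E : ℂ) • ψ)
    (Xw : FermionOp Λ') (κ u : ℝ)
    {m : Type*} [Fintype m] [DecidableEq m] {Λm : Matrix m m ℂ} (hΛm : Λm.PosSemidef)
    (O : m → FermionOp Λ')
    {κ' : Type*} (s : Finset κ') (B : κ' → FermionOp Λ)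
    {ι : Type*} (tt : Finset ι) (γ : ι → DihedralGroup 4) (hγS : ∀ l ∈ tt, γ l ∈ S) (wv : ι → Site 2)
    (hsh : ∀ l, d4ShiftSet (γ l) (wv l) Λ ⊆ Λ') (Y : ι → FermionOp Λ)
    {ρ : Type*} (uu : Finset ρ) (b : ρ → ℂ) (cw : ρ → List (Orb (PolySite Λ') × Bool))
    (hcw : ∀ j ∈ uu, ladderSpinCharge (cw j) ≠ 0)
    {δ : Type*} (ah : Finset δ) (dc : δ → ℝ) (V : δ → FermionOp Λ')
    {κ'' : Type*} (w : Finset κ'') (a : κ'' → ℂ) (word : κ'' → List (Orb (PolySite Λ') × Bool)) {c : ℝ}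
    (hcert : Xw - (c : ℂ) • (1 : FermionOp Λ') -
        ((κ : ℝ) : ℂ) • (((u : ℝ) : ℂ) • (1 : FermionOp Λ') -
          (fermionEmbed (PolySite.incl h0) ((hubbardTTPrimeFermionInteraction 1 tp U).meanEnergyObs 1) -
            (μ : ℂ) • ∑ σ : Fin 2, nAt 0 hz σ -
            (h : ℂ) • (fermionEmbed (PolySite.incl hP) (localPairAt (insert (0 : Site 2) unitSteps) dWaveFormFactor 0) +
              (fermionEmbed (PolySite.incl hP) (localPairAt (insert (0 : Site 2) unitSteps) dWaveFormFactor 0))ᴴ))) =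
      gramForm Λm O +
        (∑ k ∈ s, (pairSourceWindowHamiltonianTT' dWaveFormFactor Λ' tp U μ h * fermionEmbed (PolySite.incl hΛ) (B k) -
            fermionEmbed (PolySite.incl hΛ) (B k) * pairSourceWindowHamiltonianTT' dWaveFormFactor Λ' tp U μ h) +
          ∑ l ∈ tt, (fermionEmbed (PolySite.incl (hsh l)) (fermionEmbed (PolySite.d4Emb (γ l) (wv l) Λ) (Y l)) -
            fermionEmbed (PolySite.incl hΛ) (Y l)) +
          ∑ j ∈ uu, b j • ladderWord (cw j)) +
        (∑ m' ∈ ah, ((dc m' : ℝ) : ℂ) • ((V m')ᴴ - V m') + ∑ k ∈ w, a k • ladderWord (word k))) :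
    c - ∑ k ∈ w, ‖a k‖ + κ * (u - E / (L : ℝ) ^ 2) ≤
      (orbitState (spaceGroupUnitary S) ψ (fermionEmbed (PolySite.toTorusEmb L hInj') Xw)).re := by
  have hInjΛ : Set.InjOn (Torus.proj (d := 2) L) ↑Λ := hInj'.mono (by exact_mod_cast hΛ)
  set Γ' := fermionEmbed (PolySite.toTorusEmb L hInj') with hΓ'
  set ΓΛ := fermionEmbed (PolySite.toTorusEmb L hInjΛ) with hΓΛ
  set H := dWaveSourceTorusTT' L tp U μ h with hH
  set X := Γ' (fermionEmbed (PolySite.incl h0) ((hubbardTTPrimeFermionInteraction 1 tp U).meanEnergyObs 1) -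
      (μ : ℂ) • ∑ σ : Fin 2, nAt 0 hz σ -
      (h : ℂ) • (fermionEmbed (PolySite.incl hP) (localPairAt (insert (0 : Site 2) unitSteps) dWaveFormFactor 0) +
        (fermionEmbed (PolySite.incl hP) (localPairAt (insert (0 : Site 2) unitSteps) dWaveFormFactor 0))ᴴ)) with hX
  have hsum : ∑ v' : TorusSite 2 L, (fockTranslate v').val * X * (fockTranslate v').valᴴ = H := by
    rw [hH, hX, hΓ']
    exact sum_conj_fockTranslate_pairSourceObjectiveTT'_dWave L h0 hz hP hInj' hL tp U μ h
  set Yt : ι → Matrix (Finset (Orb (FermionTorus 2 L))) (Finset (Orb (FermionTorus 2 L))) ℂ :=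
    fun l => ΓΛ (Y l) with hYt
  set emb : Orb (PolySite Λ') × Bool → Orb (FermionTorus 2 L) × Bool :=
    fun p => (Orb.embMap (PolySite.toTorusEmb L hInj') p.1, p.2) with hemb
  set C : ρ → Matrix (Finset (Orb (FermionTorus 2 L))) (Finset (Orb (FermionTorus 2 L))) ℂ :=
    fun _ => HubbardWave0.spinZ with hC
  set W : ρ → Matrix (Finset (Orb (FermionTorus 2 L))) (Finset (Orb (FermionTorus 2 L))) ℂ :=
    fun j => (b j / (((ladderSpinCharge ((cw j).map emb) : ℤ) : ℂ) / 2)) • ladderWord ((cw j).map emb) with hW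
  have hCh : ∀ j ∈ uu, (C j).IsHermitian := fun _ _ => HubbardWave0.spinZ_isHermitian
  have hCq : ∀ j ∈ uu, ∀ φ ∈ fockSpinZSector (Λ := FermionTorus 2 L) M, C j *ᵥ φ = ((M : ℝ) : ℂ) • φ :=
    fun _ _ _ hφ => spinZ_mulVec_of_mem_fockSpinZSector hφ
  have hcharged : ∀ j ∈ uu, Γ' (b j • ladderWord (cw j)) = C j * W j - W j * C j := by
    intro j hj
    have hq : (((ladderSpinCharge ((cw j).map emb) : ℤ) : ℂ) / 2) ≠ 0 := by
      rw [hemb, ladderSpinCharge_map_embMap]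
      exact div_ne_zero (Int.cast_ne_zero.2 (hcw j hj)) two_ne_zero
    rw [fermionEmbed_smul, fermionEmbed_ladderWord, hC, hW]
    simp only [Matrix.mul_smul, Matrix.smul_mul]
    rw [← smul_sub, spinZ_comm_ladderWord, smul_smul, div_mul_cancel₀ _ hq]
  set Mw : κ'' → Matrix (Finset (Orb (FermionTorus 2 L))) (Finset (Orb (FermionTorus 2 L))) ℂ :=
    fun k => ladderWord ((word k).map emb) with hMw
  have hMc : ∀ k ∈ w, (Mw k).IsContraction := fun k _ => by
    rw [hMw]; dsimp only; rw [ladderWord_eq_prod]; exact isContraction_prod_ladder _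
  have htorus : Γ' Xw - (c : ℂ) • (1 : Matrix (Finset (Orb (FermionTorus 2 L))) (Finset (Orb (FermionTorus 2 L))) ℂ) -
      ∑ i ∈ (∅ : Finset (Fin 0)), (((0 : ℝ) : ℝ) : ℂ) • ((0 : Matrix _ _ ℂ) - (((0 : ℝ) : ℝ) : ℂ) •
        (1 : Matrix (Finset (Orb (FermionTorus 2 L))) (Finset (Orb (FermionTorus 2 L))) ℂ)) -
      ((κ : ℝ) : ℂ) • (((u : ℝ) : ℂ) •
        (1 : Matrix (Finset (Orb (FermionTorus 2 L))) (Finset (Orb (FermionTorus 2 L))) ℂ) - X) =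
      gramForm Λm (fun i => Γ' (O i)) +
        (∑ k ∈ s, (H * Γ' (fermionEmbed (PolySite.incl hΛ) (B k)) - Γ' (fermionEmbed (PolySite.incl hΛ) (B k)) * H) +
          ∑ l ∈ tt, ((fockTranslate (Torus.proj L (wv l))).val * (fockD4 (L := L) (γ l)).val * Yt l *
              ((fockTranslate (Torus.proj L (wv l))).val * (fockD4 (L := L) (γ l)).val)ᴴ - Yt l) +
          ∑ i ∈ (∅ : Finset (Fin 0)), ((0 : Matrix _ _ ℂ) * ((0 : Matrix _ _ ℂ) - (((0 : ℝ) : ℝ) : ℂ) • 1) +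
            ((0 : Matrix _ _ ℂ) - (((0 : ℝ) : ℝ) : ℂ) • 1) * (0 : Matrix _ _ ℂ)) +
          ∑ j ∈ uu, (C j * W j - W j * C j)) +
        (∑ m' ∈ ah, ((dc m' : ℝ) : ℂ) • ((Γ' (V m'))ᴴ - Γ' (V m')) + ∑ k ∈ w, a k • Mw k) := by
    have key := congrArg Γ' hcert
    rw [fermionEmbed_sub, fermionEmbed_sub, fermionEmbed_smul, fermionEmbed_one, fermionEmbed_smul,
      fermionEmbed_sub, fermionEmbed_smul, fermionEmbed_one] at key
    have h1' : Γ' (∑ k ∈ s, (pairSourceWindowHamiltonianTT' dWaveFormFactor Λ' tp U μ h * fermionEmbed (PolySite.incl hΛ) (B k) -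
        fermionEmbed (PolySite.incl hΛ) (B k) * pairSourceWindowHamiltonianTT' dWaveFormFactor Λ' tp U μ h)) =
        ∑ k ∈ s, (H * Γ' (fermionEmbed (PolySite.incl hΛ) (B k)) - Γ' (fermionEmbed (PolySite.incl hΛ) (B k)) * H) := by
      rw [fermionEmbed_sum]
      refine Finset.sum_congr rfl fun k _ => ?_
      rw [hH, hΓ', dWaveSourceTorusTT'_commutator_fermionEmbed L hΛ h8 hInj tp U μ h (B k)]
    have h2 : Γ' (∑ l ∈ tt, (fermionEmbed (PolySite.incl (hsh l)) (fermionEmbed (PolySite.d4Emb (γ l) (wv l) Λ) (Y l)) -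
        fermionEmbed (PolySite.incl hΛ) (Y l))) =
        ∑ l ∈ tt, ((fockTranslate (Torus.proj L (wv l))).val * (fockD4 (L := L) (γ l)).val * Yt l *
          ((fockTranslate (Torus.proj L (wv l))).val * (fockD4 (L := L) (γ l)).val)ᴴ - Yt l) := by
      rw [fermionEmbed_sum]
      refine Finset.sum_congr rfl fun l _ => ?_
      rw [hYt, hΓΛ]
      exact fermionEmbed_toTorusEmb_d4_sub hΛ (γ l) (wv l) (hsh l) hInj' (Y l)
    have h3 : Γ' (∑ j ∈ uu, b j • ladderWord (cw j)) = ∑ j ∈ uu, (C j * W j - W j * C j) := by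
      rw [fermionEmbed_sum]
      exact Finset.sum_congr rfl hcharged
    have h4 : Γ' (∑ m' ∈ ah, ((dc m' : ℝ) : ℂ) • ((V m')ᴴ - V m')) =
        ∑ m' ∈ ah, ((dc m' : ℝ) : ℂ) • ((Γ' (V m'))ᴴ - Γ' (V m')) := by
      rw [fermionEmbed_sum]
      refine Finset.sum_congr rfl fun m' _ => ?_
      rw [fermionEmbed_smul, fermionEmbed_sub, hΓ', fermionEmbed_conjTranspose]
    have h5 : Γ' (∑ k ∈ w, a k • ladderWord (word k)) = ∑ k ∈ w, a k • Mw k := by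
      rw [fermionEmbed_sum]
      refine Finset.sum_congr rfl fun k _ => ?_
      rw [fermionEmbed_smul, hMw, fermionEmbed_ladderWord]
    rw [Finset.sum_empty, Finset.sum_empty, sub_zero, add_zero, hX, key, fermionEmbed_add, fermionEmbed_add,
      fermionEmbed_add, fermionEmbed_add, fermionEmbed_add, hΓ', fermionEmbed_gramForm, ← hΓ', h1', h2, h3, h4, h5]
  have hmain := dWaveSourceTorusTT'_re_orbitState_ge_of_local_certificate_ineq tp U μ h h1 hmul hS hψK hψ1 hHψ
    (Γ' Xw) X hsum κ u
    (∅ : Finset (Fin 0)) (fun _ => 0) (fun _ => 0) (fun _ => 0) (fun _ => 0) (fun _ => 0)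
    (fun i hi => absurd hi (Finset.notMem_empty i)) (fun i hi => absurd hi (Finset.notMem_empty i))
    hΛm (fun i => Γ' (O i)) s (fun k => Γ' (fermionEmbed (PolySite.incl hΛ) (B k))) tt γ hγS
    (fun l => Torus.proj L (wv l)) Yt
    (∅ : Finset (Fin 0)) (fun _ => 0) (fun _ => 0) (fun _ => 0) (fun _ => 0)
    (fun i hi => absurd hi (Finset.notMem_empty i)) (fun i hi => absurd hi (Finset.notMem_empty i))
    uu C W (fun _ => M) hCh hCq ah dc (fun m' => Γ' (V m')) w a Mw hMc htorus
  rw [Finset.sum_empty, add_zero] at hmain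
  exact hmain

/-- **With the energy hypothesis** (`κ ≥ 0`, `E/L² ≤ u`): `c − Σₖ ‖aₖ‖ ≤ Re ω̄_ψ(Γ(ι_{Λ',L}) X)` for EVERY
unit `S^z`-eigenvector eigenstate of the pair-sourced `t–t'` torus below the cap, uniformly in `L` — the
cell `Summit.Ventures.CertifiedManyBodySolver.SourcedTorusCorrLowerRow`. [cite: WangEtAl2024, §III] -/
theorem re_orbitState_ge_of_sourced_window_certificate_d4_TT'_ineq_of_energy_le (tp U μ h : ℝ) (hL : 3 ≤ L)
    {M : ℝ} {Λ Λ' : Finset (Site 2)} (hΛ : Λ ⊆ Λ') (h8 : thicken Λ 1 ⊆ Λ')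
    (h0 : thicken ({0} : Finset (Site 2)) 1 ⊆ Λ') (hz : (0 : Site 2) ∈ Λ')
    (hP : pairRegion (insert (0 : Site 2) unitSteps) 0 ⊆ Λ')
    (hInj : Set.InjOn (Torus.proj (d := 2) L) ↑(thicken Λ' 1))
    (hInj' : Set.InjOn (Torus.proj (d := 2) L) ↑Λ')
    {S : Finset (DihedralGroup 4)} (h1 : (1 : DihedralGroup 4) ∈ S) (hmul : ∀ a ∈ S, ∀ b ∈ S, a * b ∈ S)
    (hS : ∀ γ ∈ S, b1gChar γ = 1)
    {ψ : Fock (Orb (FermionTorus 2 L))} (hψK : ψ ∈ fockSpinZSector (Λ := FermionTorus 2 L) M)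
    (hψ1 : star ψ ⬝ᵥ ψ = 1) {E : ℝ} (hHψ : dWaveSourceTorusTT' L tp U μ h *ᵥ ψ = (E : ℂ) • ψ)
    (Xw : FermionOp Λ') {κ u : ℝ} (hκ : 0 ≤ κ) (hu : E / (L : ℝ) ^ 2 ≤ u)
    {m : Type*} [Fintype m] [DecidableEq m] {Λm : Matrix m m ℂ} (hΛm : Λm.PosSemidef)
    (O : m → FermionOp Λ')
    {κ' : Type*} (s : Finset κ') (B : κ' → FermionOp Λ)
    {ι : Type*} (tt : Finset ι) (γ : ι → DihedralGroup 4) (hγS : ∀ l ∈ tt, γ l ∈ S) (wv : ι → Site 2)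
    (hsh : ∀ l, d4ShiftSet (γ l) (wv l) Λ ⊆ Λ') (Y : ι → FermionOp Λ)
    {ρ : Type*} (uu : Finset ρ) (b : ρ → ℂ) (cw : ρ → List (Orb (PolySite Λ') × Bool))
    (hcw : ∀ j ∈ uu, ladderSpinCharge (cw j) ≠ 0)
    {δ : Type*} (ah : Finset δ) (dc : δ → ℝ) (V : δ → FermionOp Λ')
    {κ'' : Type*} (w : Finset κ'') (a : κ'' → ℂ) (word : κ'' → List (Orb (PolySite Λ') × Bool)) {c : ℝ}
    (hcert : Xw - (c : ℂ) • (1 : FermionOp Λ') -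
        ((κ : ℝ) : ℂ) • (((u : ℝ) : ℂ) • (1 : FermionOp Λ') -
          (fermionEmbed (PolySite.incl h0) ((hubbardTTPrimeFermionInteraction 1 tp U).meanEnergyObs 1) -
            (μ : ℂ) • ∑ σ : Fin 2, nAt 0 hz σ -
            (h : ℂ) • (fermionEmbed (PolySite.incl hP) (localPairAt (insert (0 : Site 2) unitSteps) dWaveFormFactor 0) +
              (fermionEmbed (PolySite.incl hP) (localPairAt (insert (0 : Site 2) unitSteps) dWaveFormFactor 0))ᴴ))) =
      gramForm Λm O +
        (∑ k ∈ s, (pairSourceWindowHamiltonianTT' dWaveFormFactor Λ' tp U μ h * fermionEmbed (PolySite.incl hΛ) (B k) -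
            fermionEmbed (PolySite.incl hΛ) (B k) * pairSourceWindowHamiltonianTT' dWaveFormFactor Λ' tp U μ h) +
          ∑ l ∈ tt, (fermionEmbed (PolySite.incl (hsh l)) (fermionEmbed (PolySite.d4Emb (γ l) (wv l) Λ) (Y l)) -
            fermionEmbed (PolySite.incl hΛ) (Y l)) +
          ∑ j ∈ uu, b j • ladderWord (cw j)) +
        (∑ m' ∈ ah, ((dc m' : ℝ) : ℂ) • ((V m')ᴴ - V m') + ∑ k ∈ w, a k • ladderWord (word k))) :
    c - ∑ k ∈ w, ‖a k‖ ≤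
      (orbitState (spaceGroupUnitary S) ψ (fermionEmbed (PolySite.toTorusEmb L hInj') Xw)).re := by
  have hmain := re_orbitState_ge_of_sourced_window_certificate_d4_TT'_ineq tp U μ h hL hΛ h8 h0 hz hP hInj hInj'
    h1 hmul hS hψK hψ1 hHψ Xw κ u hΛm O s B tt γ hγS wv hsh Y uu b cw hcw ah dc V w a word hcert
  have hslack : 0 ≤ κ * (u - E / (L : ℝ) ^ 2) := mul_nonneg hκ (sub_nonneg.2 hu)
  linarith

end Certificate

/-- **Eventual form of the energy theorem** (library instances; the FLOOR slot
`Summit.Ventures.CertifiedManyBodySolver.SourcedEnergyLowerRow`): there is `L₀` (`= max 3 L₁`, `L₁` from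
`exists_forall_le_injOn_proj (thicken Λ' 1)`) with `(c − Σₖ ‖aₖ‖) · L² ≤ E₀(dWaveSourceTorusTT' L tp U μ h)` for
every `L ≥ L₀`. [cite: Han2020Bootstrap, §3] -/
theorem dWaveSourceTorusTT'_groundEnergy_ge_of_window_certificate_d4_eventually (tp U μ h : ℝ)
    {Λ Λ' : Finset (Site 2)} (hΛ : Λ ⊆ Λ') (h8 : thicken Λ 1 ⊆ Λ')
    (h0 : thicken ({0} : Finset (Site 2)) 1 ⊆ Λ') (hz : (0 : Site 2) ∈ Λ')
    (hP : pairRegion (insert (0 : Site 2) unitSteps) 0 ⊆ Λ')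
    {m : Type*} [Fintype m] [DecidableEq m] {Λm : Matrix m m ℂ} (hΛm : Λm.PosSemidef)
    (O : m → FermionOp Λ')
    {κ : Type*} (s : Finset κ) (B : κ → FermionOp Λ)
    {ι : Type*} (tt : Finset ι) (gam : ι → DihedralGroup 4) (v : ι → Site 2)
    (hgam : ∀ l ∈ tt, b1gChar (gam l) = 1) (hsh : ∀ l, d4ShiftSet (gam l) (v l) Λ ⊆ Λ') (Y : ι → FermionOp Λ)
    {χ : Type*} (u : Finset χ) (b : χ → ℂ) (cw : χ → List (Orb (PolySite Λ') × Bool))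
    (hcw : ∀ j ∈ u, ladderSpinCharge (cw j) ≠ 0)
    {δ : Type*} (ah : Finset δ) (dc : δ → ℝ) (V : δ → FermionOp Λ')
    {κ'' : Type*} (w : Finset κ'') (a : κ'' → ℂ) (word : κ'' → List (Orb (PolySite Λ') × Bool)) {c : ℝ}
    (hcert : fermionEmbed (PolySite.incl h0) ((hubbardTTPrimeFermionInteraction 1 tp U).meanEnergyObs 1) -
          (μ : ℂ) • ∑ σ : Fin 2, nAt 0 hz σ -
          (h : ℂ) • (fermionEmbed (PolySite.incl hP) (localPairAt (insert (0 : Site 2) unitSteps) dWaveFormFactor 0) +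
            (fermionEmbed (PolySite.incl hP) (localPairAt (insert (0 : Site 2) unitSteps) dWaveFormFactor 0))ᴴ) -
        (c : ℂ) • (1 : FermionOp Λ') =
      gramForm Λm O +
        (∑ k ∈ s, (pairSourceWindowHamiltonianTT' dWaveFormFactor Λ' tp U μ h * fermionEmbed (PolySite.incl hΛ) (B k) -
            fermionEmbed (PolySite.incl hΛ) (B k) * pairSourceWindowHamiltonianTT' dWaveFormFactor Λ' tp U μ h) +
          ∑ l ∈ tt, (fermionEmbed (PolySite.incl (hsh l)) (fermionEmbed (PolySite.d4Emb (gam l) (v l) Λ) (Y l)) -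
            fermionEmbed (PolySite.incl hΛ) (Y l)) +
          ∑ j ∈ u, b j • ladderWord (cw j)) +
        (∑ m' ∈ ah, ((dc m' : ℝ) : ℂ) • ((V m')ᴴ - V m') + ∑ k ∈ w, a k • ladderWord (word k))) :
    ∃ L₀ : ℕ, ∀ (L : ℕ) [NeZero L], L₀ ≤ L →
      (c - ∑ k ∈ w, ‖a k‖) * (L : ℝ) ^ 2 ≤ (dWaveSourceTorusTT' L tp U μ h).groundEnergy := by
  obtain ⟨L₁, hL₁⟩ := exists_forall_le_injOn_proj (thicken Λ' 1)
  refine ⟨max 3 L₁, fun L _ hL => ?_⟩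
  convert dWaveSourceTorusTT'_groundEnergy_ge_of_window_certificate_d4 tp U μ h (le_trans (le_max_left _ _) hL) hΛ
    h8 h0 hz hP (hL₁ L (le_trans (le_max_right _ _) hL)) hΛm O s B tt gam v hgam hsh Y u b cw hcw ah dc V w a
    word hcert using 2

end Literature.MathematicalPhysics.QuantumLattice

end
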